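import Literature.NumberTheory.EllipticCurves.MordellWeilTheoremProofs
import Mathlib.LinearAlgebra.Dimension.Torsion.Finite
import HarnessLib

/-!
# Mordell–Weil rank `1` by Galois descent through a group of order `9` and exponent `3`

Second input of the reduction (`RankNotSumOfLocalInvariantsF3Cubic.lean`) of the descent leaf
`DokchitserDokchitser2011_descent_480a1_F3` — "2-descent shows that `rk E/F₃ = 1` (e.g. using
Magma, over all minimal non-trivial subfields of `F_n`)", proof of Theorem 2 of
T. Dokchitser–V. Dokchitser, *A note on the Mordell–Weil rank modulo `n`*, J. Number Theory 131
(2011) 1833–1839 — to `2`-descents over the minimal non-trivial (= cubic) subfields of `F₃`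
(`Gal(F₃/ℚ) ≅ C₃ × C₃`): the GALOIS DESCENT from the cubic subfields to `F₃`, i.e. the case
`rk E(K) = rk E(ℚ) = 1` for all cubic `K ⊂ F₃` of the Artin formalism
`rk E(F₃) = rk E(ℚ) + ∑_{K ⊂ F₃ cubic} (rk E(K) - rk E(ℚ))`. Everything here is proved.

* Algebra (`G` a group of order `9` and exponent `3` acting additively on an abelian group `M`):
  the identity `6 = ∑_{g ≠ 1} (1 + g + g²) - 2 ∑_g g` in `ℤ[G]` (`six_smul_eq`; each `g ≠ 1` lies
  in exactly one of the four subgroups of order `3`), whence: if every element fixed by some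
  `g ≠ 1` is rationally dependent on a fixed `m₀ ∈ M` (`a m = b m₀`, `a ≠ 0`), so is every element
  of `M` (`dep_of_exponent_three`); and a finitely generated abelian group all of whose elements
  are rationally dependent on one element of infinite order has `ℤ`-rank `1`
  (`finrank_eq_one_of_forall_dep`, by Mathlib's `rank_le` and `LinearIndependent.pair_iff`).
* Elliptic curves (`mordellWeilRank_baseChange_eq_one_of_exponent_three`): for a number field `F`
  with `|Aut(F/ℚ)| = 9` of exponent `3`, an elliptic curve `E/ℚ` with a rational point of
  infinite order, and number fields `K_σ → F` covering the fixed field of each `σ ≠ 1` with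
  `rank_ℤ E(K_σ) ≤ 1`, one has `rank_ℤ E(F) = 1`. `Aut(F/ℚ)` acts on `E(F)` through Mathlib's
  `WeierstrassCurve.Affine.Point.map`; a point fixed by `σ` has coordinates in the image of
  `K_σ`, and two points of `E(K_σ)` are linearly dependent because
  `rank_ℤ E(K_σ) ≤ 1 < 2` (Mathlib `LinearIndependent.fintype_card_le_finrank`). Ranks
  (`WeierstrassCurve.mordellWeilRank = Module.finrank ℤ E(·)`) are honest by the Mordell–Weil
  theorem, proved in the tree (`WeierstrassCurve.module_finite_point_holds`,
  `MordellWeilTheoremProofs.lean`). Also `mordellWeilRank_baseChange_le_of_algHom`: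
  `rank_ℤ E(K) ≤ rank_ℤ E(F)` along `K → F` (for the converse of the reduction).

Design notes. Theorems only. The action is an unbundled `ρ : G → M →+ M` with `ρ (gh) = ρ g ∘ ρ h`,
`ρ 1 = id` as hypotheses (for `Point.map` both hold by `rfl` on points), and "rank `≤ 1`" enters
elementwise (rational dependence), so that no `Module ℤ` structure on a submodule is ever named:
on `↥N` instance search finds `AddCommGroup.toIntModule` while Mathlib's submodule lemmas carry
`Submodule.module`, and the two (propositionally equal) structures are not syntactically
interchangeable. The curve statement is generic in the field `F : Type` (and in `K_σ`, with its
`ℚ`-algebra structure supplied explicitly) so that the group law on `E(F)` is elaborated against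
the classical decidability instance used inside `WeierstrassCurve.mordellWeilRank`; it is
specialised to `F₃ ⊂ ℚ(ζ₁₃₃₉)` only in `RankNotSumOfLocalInvariantsF3Cubic.lean`.

## References

* T. Dokchitser, V. Dokchitser, *A note on the Mordell–Weil rank modulo `n`*, J. Number Theory 131
  (2011) 1833–1839, arXiv:0910.4588, proof of Thm. 2. [DokchitserDokchitser2011RankModN]
* J. H. Silverman, *The Arithmetic of Elliptic Curves*, 2nd ed., GTM 106 (2009), VIII.§1 and
  Thm. VIII.6.7 (Mordell–Weil). [SilvermanAEC2009]
-/

noncomputable section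

open scoped Classical

open Module

namespace Literature.Barriers.BirchSwinnertonDyer.DokchitserDokchitser2011

/-! ### Algebra: an abelian group with an action of a group of order `9` and exponent `3` -/

section Algebra

variable {M : Type*} [AddCommGroup M] {G : Type*} [Group G] (ρ : G → M →+ M)
  (hmul : ∀ (g h : G) (m : M), ρ (g * h) m = ρ g (ρ h m))

section Action

include hmul

/-- The norm `N m = ∑_{g ∈ G} g m` is `G`-invariant. [folklore] -/
theorem apply_sum_apply [Fintype G] (h : G) (m : M) : ρ h (∑ g, ρ g m) = ∑ g, ρ g m := by
  rw [map_sum]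
  simp_rw [← hmul]
  exact Fintype.sum_equiv (Equiv.mulLeft h) _ _ fun g => rfl

variable (hone : ∀ m : M, ρ 1 m = m) (hexp : ∀ g : G, g ^ 3 = 1)
include hone hexp

/-- If `g³ = 1` then `g (g (g m)) = m`. [folklore] -/
theorem apply_apply_apply (g : G) (m : M) : ρ g (ρ g (ρ g m)) = m := by
  rw [← hmul, ← hmul, ← pow_three', hexp, hone]

/-- If `g³ = 1` then the partial trace `T_g m = m + g m + g² m` is fixed by `g`. [folklore] -/
theorem apply_trace (g : G) (m : M) :
    ρ g (m + ρ g m + ρ g (ρ g m)) = m + ρ g m + ρ g (ρ g m) := by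
  rw [map_add, map_add, apply_apply_apply ρ hmul hone hexp]
  abel

omit hmul hone in
/-- In a group of exponent `3`, squaring is a bijection (an involution: `(g²)² = g⁴ = g`).
[folklore] -/
theorem bijective_mul_self : Function.Bijective fun g : G => g * g := by
  refine Function.Involutive.bijective fun g => ?_
  rw [show (g * g) * (g * g) = g ^ 3 * g by simp only [pow_succ, pow_zero, one_mul, mul_assoc],
    hexp, one_mul]

omit hone in
/-- `∑_g T_g m = |G| • m + 2 • N m` (the middle sum `∑_g g² m` is again `N m` because squaring
permutes `G`). [folklore] -/
theorem sum_trace [Fintype G] (m : M) :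
    ∑ g, (m + ρ g m + ρ g (ρ g m)) = (Fintype.card G : ℤ) • m + (2 : ℤ) • ∑ g, ρ g m := by
  have h2 : ∑ g, ρ g (ρ g m) = ∑ g, ρ g m := by
    simp_rw [← hmul]
    exact Function.Bijective.sum_comp (bijective_mul_self hexp) fun g => ρ g m
  simp only [Finset.sum_add_distrib, Finset.sum_const, Finset.card_univ, h2]
  rw [two_smul, natCast_zsmul, add_assoc]

/-- **The descent identity.** If `|G| = 9` and `G` has exponent `3`, then for every `m ∈ M`
`6 • m = ∑_{g ≠ 1} T_g m - 2 • N m`, where `T_g m = m + g m + g² m` is fixed by `g` and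
`N m = ∑_g g m` by `G`; in `ℤ[G]`: `6 = ∑_{g ≠ 1} (1 + g + g²) - 2 ∑_g g` (every `g ≠ 1` lies in
exactly one of the four subgroups of order `3`). [folklore] -/
theorem six_smul_eq [Fintype G] (hcard : Fintype.card G = 9) (m : M) :
    (6 : ℤ) • m = ∑ g ∈ Finset.univ.erase 1, (m + ρ g m + ρ g (ρ g m)) - (2 : ℤ) • ∑ g, ρ g m := by
  have h1 : m + ρ 1 m + ρ 1 (ρ 1 m) = (3 : ℤ) • m := by
    rw [hone, hone]
    module
  have h := sum_trace ρ hmul hexp m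
  rw [← Finset.add_sum_erase _ _ (Finset.mem_univ (1 : G)), hcard, h1] at h
  -- h : 3 • m + ∑_{g ≠ 1} T_g m = 9 • m + 2 • N m
  rw [eq_sub_of_add_eq' h]
  push_cast
  module

end Action

/-! Rational dependence on a fixed element `m₀`: `a • m = b • m₀` for some `a ≠ 0`. -/

omit ρ in
/-- `0` is rationally dependent on `m₀`. [folklore] -/
theorem dep_zero (m₀ : M) : ∃ a b : ℤ, a ≠ 0 ∧ a • (0 : M) = b • m₀ :=
  ⟨1, 0, one_ne_zero, by rw [smul_zero, zero_smul]⟩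

omit ρ in
/-- Rational dependence on `m₀` is closed under addition. [folklore] -/
theorem dep_add {m₀ x y : M} (hx : ∃ a b : ℤ, a ≠ 0 ∧ a • x = b • m₀)
    (hy : ∃ a b : ℤ, a ≠ 0 ∧ a • y = b • m₀) : ∃ a b : ℤ, a ≠ 0 ∧ a • (x + y) = b • m₀ := by
  obtain ⟨a, b, ha, hx⟩ := hx
  obtain ⟨a', b', ha', hy⟩ := hy
  refine ⟨a * a', a' * b + a * b', mul_ne_zero ha ha', ?_⟩
  rw [smul_add, mul_smul a a' y, hy, mul_comm a a', mul_smul a' a x, hx, smul_smul, smul_smul,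
    ← add_smul]

omit ρ in
/-- Rational dependence on `m₀` is closed under integer multiples. [folklore] -/
theorem dep_smul {m₀ x : M} (c : ℤ) (hx : ∃ a b : ℤ, a ≠ 0 ∧ a • x = b • m₀) :
    ∃ a b : ℤ, a ≠ 0 ∧ a • (c • x) = b • m₀ := by
  obtain ⟨a, b, ha, hx⟩ := hx
  exact ⟨a, c * b, ha, by rw [smul_comm, hx, mul_smul]⟩

omit ρ in
/-- Rational dependence on `m₀` is closed under subtraction. [folklore] -/
theorem dep_sub {m₀ x y : M} (hx : ∃ a b : ℤ, a ≠ 0 ∧ a • x = b • m₀)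
    (hy : ∃ a b : ℤ, a ≠ 0 ∧ a • y = b • m₀) : ∃ a b : ℤ, a ≠ 0 ∧ a • (x - y) = b • m₀ := by
  rw [sub_eq_add_neg, ← neg_one_smul ℤ y]
  exact dep_add hx (dep_smul (-1) hy)

omit ρ in
/-- Rational dependence on `m₀` is closed under finite sums. [folklore] -/
theorem dep_sum {m₀ : M} {ι : Type*} (s : Finset ι) (f : ι → M)
    (hf : ∀ i ∈ s, ∃ a b : ℤ, a ≠ 0 ∧ a • f i = b • m₀) :
    ∃ a b : ℤ, a ≠ 0 ∧ a • (∑ i ∈ s, f i) = b • m₀ := by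
  induction s using Finset.induction_on with
  | empty => rw [Finset.sum_empty]; exact dep_zero m₀
  | insert i s hi ih =>
    rw [Finset.sum_insert hi]
    exact dep_add (hf i (Finset.mem_insert_self i s))
      (ih fun j hj => hf j (Finset.mem_insert_of_mem hj))

omit ρ in
/-- If a non-zero multiple of `m` is rationally dependent on `m₀`, so is `m`. [folklore] -/
theorem dep_of_smul {m₀ m : M} {n : ℤ} (hn : n ≠ 0) (h : ∃ a b : ℤ, a ≠ 0 ∧ a • (n • m) = b • m₀) :
    ∃ a b : ℤ, a ≠ 0 ∧ a • m = b • m₀ := by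
  obtain ⟨a, b, ha, hab⟩ := h
  exact ⟨a * n, b, mul_ne_zero ha hn, by rw [mul_smul, hab]⟩

/-- **Descent through a group of order `9` and exponent `3`.** Let `G` (of order `9` and exponent
`3`, i.e. `G ≅ C₃ × C₃`) act additively on an abelian group `M`. If for every `g ≠ 1` every
element of `M^g` is rationally dependent on a fixed `m₀`, then so is every element of `M`: by
`six_smul_eq`, `6 • m` is a sum of elements of the `M^g`, `g ≠ 1`, minus `2 • N m`, and
`N m ∈ M^G ⊆ M^{g₀}` for any `g₀ ≠ 1`. (This is the case `rk M^H = rk M^G = 1` of the Artin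
formalism `rk M = rk M^G + ∑_{H ≤ G, |H| = 3} (rk M^H - rk M^G)` for `C₃ × C₃`.) [folklore] -/
theorem dep_of_exponent_three [Fintype G] (hmul : ∀ (g h : G) (m : M), ρ (g * h) m = ρ g (ρ h m))
    (hone : ∀ m : M, ρ 1 m = m) (hexp : ∀ g : G, g ^ 3 = 1) (hcard : Fintype.card G = 9) {m₀ : M}
    (hdep : ∀ g : G, g ≠ 1 → ∀ x : M, ρ g x = x → ∃ a b : ℤ, a ≠ 0 ∧ a • x = b • m₀) (m : M) :
    ∃ a b : ℤ, a ≠ 0 ∧ a • m = b • m₀ := by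
  obtain ⟨g₀, hg₀⟩ := Fintype.exists_ne_of_one_lt_card (by omega) (1 : G)
  refine dep_of_smul (by norm_num : (6 : ℤ) ≠ 0) ?_
  rw [six_smul_eq ρ hmul hone hexp hcard m]
  exact dep_sub
    (dep_sum _ _ fun g hg =>
      hdep g (Finset.ne_of_mem_erase hg) _ (apply_trace ρ hmul hone hexp g m))
    (dep_smul _ (hdep g₀ hg₀ _ (apply_sum_apply ρ hmul g₀ m)))

omit ρ in
/-- **Rank one.** A finitely generated abelian group all of whose elements are rationally dependent
on one element `m₀` of infinite order has `ℤ`-rank `1`: two elements `x, y` with `a x = b m₀`,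
`a' y = b' m₀` satisfy the relation `b' a x - b a' y = 0` (non-trivial unless `b = b' = 0`, when
`a x = 0` is one), so no two elements are linearly independent (Mathlib `rank_le`); and `M` is
not torsion. [folklore] -/
theorem finrank_eq_one_of_forall_dep [Module.Finite ℤ M] {m₀ : M}
    (hm₀ : ∀ a : ℤ, a ≠ 0 → a • m₀ ≠ 0) (h : ∀ m : M, ∃ a b : ℤ, a ≠ 0 ∧ a • m = b • m₀) :
    finrank ℤ M = 1 := by
  apply le_antisymm
  · apply finrank_le_of_rank_le
    apply rank_le
    intro s hs
    by_contra hlt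
    rw [not_le, Finset.one_lt_card] at hlt
    obtain ⟨x, hx, y, hy, hxy⟩ := hlt
    have hpair : LinearIndependent ℤ ![x, y] := by
      have hinj : Function.Injective (![⟨x, hx⟩, ⟨y, hy⟩] : Fin 2 → s) := by
        intro i j hij
        fin_cases i <;> fin_cases j
        · rfl
        · exact absurd (congrArg Subtype.val hij) hxy
        · exact absurd (congrArg Subtype.val hij).symm hxy
        · rfl
      convert hs.comp _ hinj using 1
      ext i
      fin_cases i <;> rfl
    rw [LinearIndependent.pair_iff] at hpair
    obtain ⟨a, b, ha, hab⟩ := h x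
    obtain ⟨a', b', ha', hab'⟩ := h y
    have h1 := hpair (b' * a) (-(b * a')) (by
      rw [mul_smul, hab, neg_smul, mul_smul, hab', smul_smul, smul_smul, mul_comm b' b,
        add_neg_cancel])
    have hb : b = 0 := by
      rcases mul_eq_zero.mp (neg_eq_zero.mp h1.2) with h' | h'
      · exact h'
      · exact absurd h' ha'
    rw [hb, zero_smul] at hab
    exact ha (hpair a 0 (by rw [hab, zero_smul, add_zero])).1
  · by_contra hlt
    have h0 : finrank ℤ M = 0 := by omega
    rw [Module.finrank_eq_zero_iff_isTorsion] at h0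
    obtain ⟨⟨a, ha⟩, hax⟩ := @h0 m₀
    exact hm₀ a (nonZeroDivisors.ne_zero ha) hax

end Algebra

/-! ### Elliptic curves: the Galois action on `E(F)` and the rank over `F` -/

section Curve

open WeierstrassCurve WeierstrassCurve.Affine

variable {F : Type} [Field F] [NumberField F] (W : WeierstrassCurve ℚ) [W.IsElliptic]

/-- **Rank `1` by descent through an automorphism group of order `9` and exponent `3`.** Let `F`
be a number field whose automorphism group `Aut(F/ℚ)` has order `9` and exponent `3` (so `F/ℚ`
is Galois with group `C₃ × C₃`), and `E/ℚ` an elliptic curve with a rational point of infinite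
order. Suppose that for every `σ ≠ 1` there is a number field `K_σ → F` whose image contains the
fixed field of `σ` and with `rank_ℤ E(K_σ) ≤ 1`. Then `rank_ℤ E(F) = 1`. The automorphisms act
on `E(F)` by transport of coordinates (Mathlib `WeierstrassCurve.Affine.Point.map`); a point
fixed by `σ` comes from `E(K_σ)`, where it is rationally dependent on `P` because two independent
points would give `rank_ℤ E(K_σ) ≥ 2` (Mathlib `LinearIndependent.fintype_card_le_finrank`); all
ranks are honest by the Mordell–Weil theorem (tree theorem
`WeierstrassCurve.module_finite_point_holds`); conclude by `dep_of_exponent_three` and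
`finrank_eq_one_of_forall_dep`. [folklore] -/
theorem mordellWeilRank_baseChange_eq_one_of_exponent_three (h9 : Nat.card (F ≃ₐ[ℚ] F) = 9)
    (h3 : ∀ σ : F ≃ₐ[ℚ] F, σ ^ 3 = 1)
    (hP : ∃ P : (W.baseChange ℚ).toAffine.Point, ∀ n : ℕ, 0 < n → n • P ≠ 0)
    (hK : ∀ σ : F ≃ₐ[ℚ] F, σ ≠ 1 →
      ∃ (K : Type) (_ : Field K) (_ : NumberField K) (_ : Algebra ℚ K) (f : K →ₐ[ℚ] F),
        (∀ x : F, σ x = x → x ∈ f.range) ∧ (W.baseChange K).mordellWeilRank ≤ 1) :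
    (W.baseChange F).mordellWeilRank = 1 := by
  obtain ⟨P, hP⟩ := hP
  haveI : (W.baseChange F).IsElliptic := inferInstanceAs (W.map (algebraMap ℚ F)).IsElliptic
  haveI : Module.Finite ℤ (W.baseChange F).toAffine.Point :=
    (W.baseChange F).module_finite_point_holds
  have hcard : Fintype.card (F ≃ₐ[ℚ] F) = 9 := by rw [← Nat.card_eq_fintype_card, h9]
  set m₀ : (W.baseChange F).toAffine.Point := Point.baseChange (W' := W.toAffine) ℚ F P
    with hm₀def
  have hm₀ : ∀ a : ℤ, a ≠ 0 → a • m₀ ≠ 0 := by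
    intro a ha h
    rw [hm₀def, ← map_zsmul, ← map_zero (Point.baseChange (W' := W.toAffine) ℚ F)] at h
    exact hP a.natAbs (Int.natAbs_pos.mpr ha) (natAbs_nsmul_eq_zero.mpr (Point.map_injective _ h))
  -- the action of `Aut(F/ℚ)` on `E(F)`
  refine finrank_eq_one_of_forall_dep hm₀ (dep_of_exponent_three
    (fun σ : F ≃ₐ[ℚ] F => Point.map (W' := W.toAffine) (σ : F →ₐ[ℚ] F))
    (fun σ τ m => by rcases m with _ | ⟨x, y, h⟩ <;> rfl)
    (fun m => by rcases m with _ | ⟨x, y, h⟩ <;> rfl) h3 hcard (fun σ hσ m hm => ?_))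
  -- a point `m` fixed by `σ ≠ 1` is rationally dependent on `m₀`
  obtain ⟨K, _, _, _, f, hfK, hrank⟩ := hK σ hσ
  haveI : (W.baseChange K).IsElliptic := inferInstanceAs (W.map (algebraMap ℚ K)).IsElliptic
  haveI : Module.Finite ℤ (W.baseChange K).toAffine.Point :=
    (W.baseChange K).module_finite_point_holds
  set ι : (W.baseChange K).toAffine.Point →+ (W.baseChange F).toAffine.Point :=
    Point.map (W' := W.toAffine) f with hι
  -- `m = ι m'`: the coordinates of `m` are fixed by `σ`, hence come from `K`
  obtain ⟨m', rfl⟩ : ∃ m' : (W.baseChange K).toAffine.Point, ι m' = m := by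
    rcases m with _ | ⟨x, y, h⟩
    · exact ⟨0, rfl⟩
    · rw [Point.map_some] at hm
      obtain ⟨hx, hy⟩ := Point.some.inj hm
      rw [AlgEquiv.coe_toAlgHom] at hx hy
      obtain ⟨x₀, rfl⟩ := (AlgHom.mem_range f).mp (hfK x hx)
      obtain ⟨y₀, rfl⟩ := (AlgHom.mem_range f).mp (hfK y hy)
      have h₀ : (W.baseChange K).toAffine.Nonsingular x₀ y₀ :=
        (baseChange_nonsingular (W := W.toAffine) (f := f) f.injective x₀ y₀).mp h
      exact ⟨Point.some x₀ y₀ h₀, rfl⟩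
  -- `m₀ = ι P'` with `P'` the image of `P` in `E(K)`
  set P' : (W.baseChange K).toAffine.Point := Point.baseChange (W' := W.toAffine) ℚ K P with hP'
  have hιP' : ι P' = m₀ := Point.map_baseChange (W' := W.toAffine) f P
  -- two points of `E(K)` are linearly dependent since `rank E(K) ≤ 1`
  have hdep : ¬ LinearIndependent ℤ ![m', P'] := fun hli => by
    have := hli.fintype_card_le_finrank
    rw [Fintype.card_fin] at this
    exact absurd (this.trans hrank) (by norm_num)
  rw [LinearIndependent.pair_iff] at hdep
  push Not at hdep
  obtain ⟨s, t, hst, hst0⟩ := hdep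
  have hrel : s • ι m' + t • m₀ = 0 := by
    rw [← hιP', ← map_zsmul, ← map_zsmul, ← map_add, hst, map_zero]
  by_cases hs : s = 0
  · rw [hs, zero_smul, zero_add] at hrel
    exact absurd hrel (hm₀ t (hst0 hs))
  · exact ⟨s, -t, hs, by rw [eq_neg_of_add_eq_zero_left hrel, neg_smul]⟩

/-- **The rank is monotone in the field**: for number fields `K → F` and `E/ℚ`,
`rank_ℤ E(K) ≤ rank_ℤ E(F)` (`E(K) → E(F)` is injective, Mathlib `Point.map_injective`; `E(F)` is
finitely generated by the Mordell–Weil theorem `WeierstrassCurve.module_finite_point_holds`).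
[folklore] -/
theorem mordellWeilRank_baseChange_le_of_algHom {K : Type} [Field K] [NumberField K]
    [Algebra ℚ K] (f : K →ₐ[ℚ] F) :
    (W.baseChange K).mordellWeilRank ≤ (W.baseChange F).mordellWeilRank := by
  haveI : (W.baseChange F).IsElliptic := inferInstanceAs (W.map (algebraMap ℚ F)).IsElliptic
  haveI : Module.Finite ℤ (W.baseChange F).toAffine.Point :=
    (W.baseChange F).module_finite_point_holds
  exact LinearMap.finrank_le_finrank_of_injective
    (f := (Point.map (W' := W.toAffine) f).toIntLinearMap)
    (Point.map_injective (W' := W.toAffine) f)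

end Curve

end Literature.Barriers.BirchSwinnertonDyer.DokchitserDokchitser2011

end
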